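import Literature.NumberTheory.EllipticCurves.ModularSymbolRepProofs
import Literature.NumberTheory.EllipticCurves.KleinJRealValues
import Literature.NumberTheory.EllipticCurves.HaberlandStokesProofs

/-!
# `ManinStokes` (stmt-KontsevichZagierPeriods-5277): decay of `ω/dj` at the cusp of the tile

Support file (prover-owned, `--supports stmt-KontsevichZagierPeriods-5277`). For the Cauchy relation of the
`(2,3,∞)`-tile `τ₀` in the coordinate `u = j` (`three_term_of_tiles`,
`HeckeMultiplicityOneManinStokesTiles.lean`) the integrand `G(u) = (ω/dj)(ψ u)` (`ψ` a right inverse of `j`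
on the closed lower half plane with values in the closed half fundamental domain) must tend to `0` as
`u → ∞`: this file proves it for every cusp function `φ` (`IsCuspFunction h φ`):

* `norm_djQuot_le_of_two_le_im` — `‖(ω/dj)(z)‖ ≤ 16 ‖φ z‖ e^{−2π im z}` for `im z ≥ 2`
  (`Δ = q ∏(1−qⁿ)²⁴`, `E₄ = 1 + O(q)`, `E₆² = E₄³ − 1728Δ`, tree estimates of `KleinJCuspExpansion`);
* `exists_norm_kleinJ_le` — `j` is bounded on the truncated fundamental domain (compactness, Mathlib);
* `djQuot_tileInv_decay` — `∀ ε > 0, ∃ R, im u ≤ 0 → R ≤ ‖u‖ → ‖(ω/dj)(ψ u)‖ ≤ ε`.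

References: J.-P. Serre, *A Course in Arithmetic* (1973), VII §3–§4; M. Kontsevich, D. Zagier, *Periods* (2001),
§1.2, §3.4. No definitions, no named facts.
-/

noncomputable section

open scoped MatrixGroups ModularForm Modular Topology
open CongruenceSubgroup Complex Set Filter
open UpperHalfPlane hiding I
open Literature.NumberTheory.EllipticCurves Literature.NumberTheory.EllipticCurves.ModularForms
open ModularForm

namespace Summit.KontsevichZagierPeriods.HeckeMultiplicityOne.ManinStokes

/-! ### The cusp estimate for `ω/dj = −φΔ/(E₄²E₆)` -/

/-- For `im z ≥ 2` the nome satisfies `‖q‖ = e^{−2π im z} ≤ 10⁻⁴`. [folklore] -/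
theorem norm_qParam_le_of_two_le_im {z : ℍ} (hz : 2 ≤ z.im) :
    ‖Function.Periodic.qParam 1 (z : ℂ)‖ = Real.exp (-(2 * Real.pi * z.im)) ∧
      ‖Function.Periodic.qParam 1 (z : ℂ)‖ ≤ 1 / 10 ^ 4 := by
  have hnq : ‖Function.Periodic.qParam 1 (z : ℂ)‖ = Real.exp (-(2 * Real.pi * z.im)) := by
    rw [Function.Periodic.norm_qParam]; simp
  refine ⟨hnq, ?_⟩
  rw [hnq]
  refine le_trans (Real.exp_le_exp.mpr ?_) exp_neg_four_pi_le
  have := Real.pi_pos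
  nlinarith

/-- **`‖Δ(z)‖ ≤ 2‖q‖` for `im z ≥ 2`** (`Δ = q∏(1 − qⁿ)²⁴` and `‖(∏…)⁻¹ − 1 − 24q‖ ≤ 625‖q‖²`). [folklore] -/
theorem norm_discriminant_le_of_two_le_im {z : ℍ} (hz : 2 ≤ z.im) :
    ‖ModularForm.discriminant z‖ ≤ 2 * ‖Function.Periodic.qParam 1 (z : ℂ)‖ := by
  obtain ⟨-, hqle⟩ := norm_qParam_le_of_two_le_im hz
  set q := Function.Periodic.qParam 1 (z : ℂ) with hq
  set r := ‖q‖ with hr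
  have hr0 : 0 ≤ r := norm_nonneg _
  set P := ∏' n : ℕ, (1 - q ^ (n + 1)) ^ 24 with hP
  have hΔ : ModularForm.discriminant z = q * P := ModularForm.discriminant_eq_q_prod z
  have hP0 : P ≠ 0 := by
    intro h0
    exact ModularForm.discriminant_ne_zero z (by rw [hΔ, h0, mul_zero])
  have h3 : ‖P⁻¹ - 1 - 24 * q‖ ≤ 625 * r ^ 2 := norm_inv_tprod_sub_sub_le hqle
  have h24 : ‖(24 : ℂ) * q‖ = 24 * r := by rw [norm_mul, hr]; norm_num
  have hPinv : 1 / 2 ≤ ‖P⁻¹‖ := by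
    have hid : (1 : ℂ) = P⁻¹ - (P⁻¹ - 1 - 24 * q) - 24 * q := by ring
    have h1 : ‖(1 : ℂ)‖ ≤ ‖P⁻¹‖ + ‖P⁻¹ - 1 - 24 * q‖ + ‖(24 : ℂ) * q‖ := by
      calc ‖(1 : ℂ)‖ = ‖P⁻¹ - (P⁻¹ - 1 - 24 * q) - 24 * q‖ := by rw [← hid]
        _ ≤ ‖P⁻¹ - (P⁻¹ - 1 - 24 * q)‖ + ‖(24 : ℂ) * q‖ := norm_sub_le _ _
        _ ≤ ‖P⁻¹‖ + ‖P⁻¹ - 1 - 24 * q‖ + ‖(24 : ℂ) * q‖ := by gcongr; exact norm_sub_le _ _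
    rw [norm_one, h24] at h1
    nlinarith
  have hPpos : 0 < ‖P‖ := norm_pos_iff.mpr hP0
  have hPle : ‖P‖ ≤ 2 := by
    rw [norm_inv] at hPinv
    have h := mul_le_mul_of_nonneg_left hPinv hPpos.le
    rw [mul_inv_cancel₀ hPpos.ne'] at h
    linarith
  rw [hΔ, norm_mul, ← hr]
  nlinarith

/-- **`‖E₄(z)‖ ≥ 1/2` and `‖E₄(z)³ − 1‖ ≤ 1/10` for `im z ≥ 2`** (`E₄ = 1 + 240q + O(q²)`). [folklore] -/
theorem norm_E₄_ge_of_two_le_im {z : ℍ} (hz : 2 ≤ z.im) :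
    1 / 2 ≤ ‖E₄ z‖ ∧ ‖E₄ z ^ 3 - 1‖ ≤ 1 / 10 := by
  obtain ⟨-, hqle⟩ := norm_qParam_le_of_two_le_im hz
  set q := Function.Periodic.qParam 1 (z : ℂ) with hq
  set r := ‖q‖ with hr
  have hr0 : 0 ≤ r := norm_nonneg _
  have h4 : ‖ModularForm.E₄ z - 1 - 240 * q‖ ≤ 61560 * r ^ 2 := norm_E₄_sub_sub_le z hqle
  have h43 : ‖ModularForm.E₄ z ^ 3 - 1 - 720 * q‖ ≤ 370000 * r ^ 2 := norm_E₄_cube_sub_sub_le z hqle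
  constructor
  · have hid : (1 : ℂ) = ModularForm.E₄ z - (ModularForm.E₄ z - 1 - 240 * q) - 240 * q := by ring
    have h1 : ‖(1 : ℂ)‖ ≤ ‖ModularForm.E₄ z‖ + ‖ModularForm.E₄ z - 1 - 240 * q‖ + ‖(240 : ℂ) * q‖ := by
      calc ‖(1 : ℂ)‖ = ‖ModularForm.E₄ z - (ModularForm.E₄ z - 1 - 240 * q) - 240 * q‖ := by rw [← hid]
        _ ≤ ‖ModularForm.E₄ z - (ModularForm.E₄ z - 1 - 240 * q)‖ + ‖(240 : ℂ) * q‖ := norm_sub_le _ _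
        _ ≤ ‖ModularForm.E₄ z‖ + ‖ModularForm.E₄ z - 1 - 240 * q‖ + ‖(240 : ℂ) * q‖ := by
            gcongr; exact norm_sub_le _ _
    have h240 : ‖(240 : ℂ) * q‖ = 240 * r := by rw [norm_mul, hr]; norm_num
    rw [norm_one, h240] at h1
    change 1 / 2 ≤ ‖ModularForm.E₄ z‖
    nlinarith
  · have hid : ModularForm.E₄ z ^ 3 - 1 = (ModularForm.E₄ z ^ 3 - 1 - 720 * q) + 720 * q := by ring
    have h720 : ‖(720 : ℂ) * q‖ = 720 * r := by rw [norm_mul, hr]; norm_num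
    change ‖ModularForm.E₄ z ^ 3 - 1‖ ≤ 1 / 10
    rw [hid]
    calc ‖ModularForm.E₄ z ^ 3 - 1 - 720 * q + 720 * q‖
        ≤ ‖ModularForm.E₄ z ^ 3 - 1 - 720 * q‖ + ‖(720 : ℂ) * q‖ := norm_add_le _ _
      _ ≤ 370000 * r ^ 2 + 720 * r := by rw [h720]; linarith
      _ ≤ 1 / 10 := by nlinarith

/-- **`‖E₆(z)‖ ≥ 1/2` for `im z ≥ 2`** (`E₆² = E₄³ − 1728Δ`, Mathlib's
`ModularForm.discriminant_eq_E₄_cube_sub_E₆_sq`). [folklore] -/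
theorem norm_E₆_ge_of_two_le_im {z : ℍ} (hz : 2 ≤ z.im) : 1 / 2 ≤ ‖E₆ z‖ := by
  obtain ⟨-, hqle⟩ := norm_qParam_le_of_two_le_im hz
  have hΔ := norm_discriminant_le_of_two_le_im hz
  obtain ⟨-, h43⟩ := norm_E₄_ge_of_two_le_im hz
  set r := ‖Function.Periodic.qParam 1 (z : ℂ)‖ with hr
  have hr0 : 0 ≤ r := norm_nonneg _
  have hE6sq : ModularForm.E₆ z ^ 2 = ModularForm.E₄ z ^ 3 - 1728 * ModularForm.discriminant z := by
    rw [ModularForm.discriminant_eq_E₄_cube_sub_E₆_sq]; ring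
  have hsq : 1 / 4 ≤ ‖ModularForm.E₆ z ^ 2‖ := by
    rw [hE6sq]
    have hid : (1 : ℂ) = (ModularForm.E₄ z ^ 3 - 1728 * ModularForm.discriminant z) -
        (ModularForm.E₄ z ^ 3 - 1) + 1728 * ModularForm.discriminant z := by ring
    have h1 : ‖(1 : ℂ)‖ ≤ ‖ModularForm.E₄ z ^ 3 - 1728 * ModularForm.discriminant z‖ +
        ‖ModularForm.E₄ z ^ 3 - 1‖ + ‖(1728 : ℂ) * ModularForm.discriminant z‖ := by
      calc ‖(1 : ℂ)‖ = ‖(ModularForm.E₄ z ^ 3 - 1728 * ModularForm.discriminant z) -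
            (ModularForm.E₄ z ^ 3 - 1) + 1728 * ModularForm.discriminant z‖ := by rw [← hid]
        _ ≤ ‖(ModularForm.E₄ z ^ 3 - 1728 * ModularForm.discriminant z) - (ModularForm.E₄ z ^ 3 - 1)‖ +
            ‖(1728 : ℂ) * ModularForm.discriminant z‖ := norm_add_le _ _
        _ ≤ ‖ModularForm.E₄ z ^ 3 - 1728 * ModularForm.discriminant z‖ + ‖ModularForm.E₄ z ^ 3 - 1‖ +
            ‖(1728 : ℂ) * ModularForm.discriminant z‖ := by gcongr; exact norm_sub_le _ _
    have h1728 : ‖(1728 : ℂ) * ModularForm.discriminant z‖ ≤ 1728 * (2 * r) := by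
      rw [norm_mul]; norm_num; linarith
    rw [norm_one] at h1
    change ‖ModularForm.E₄ z ^ 3 - 1‖ ≤ 1 / 10 at h43
    nlinarith
  rw [norm_pow] at hsq
  change 1 / 2 ≤ ‖ModularForm.E₆ z‖
  nlinarith [norm_nonneg (ModularForm.E₆ z)]

/-- **The cusp estimate**: `‖(ω/dj)(z)‖ ≤ 16 ‖φ z‖ e^{−2π im z}` for `im z ≥ 2`. [folklore] -/
theorem norm_djQuot_le_of_two_le_im (φ : ℍ → ℂ) {z : ℍ} (hz : 2 ≤ z.im) :
    ‖djQuot φ z‖ ≤ 16 * ‖φ z‖ * Real.exp (-(2 * Real.pi * z.im)) := by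
  obtain ⟨hnq, -⟩ := norm_qParam_le_of_two_le_im hz
  have hΔ := norm_discriminant_le_of_two_le_im hz
  obtain ⟨h4, -⟩ := norm_E₄_ge_of_two_le_im hz
  have h6 := norm_E₆_ge_of_two_le_im hz
  rw [← hnq]
  set r := ‖Function.Periodic.qParam 1 (z : ℂ)‖ with hr
  have hden : 1 / 8 ≤ ‖E₄ z‖ ^ 2 * ‖E₆ z‖ := by nlinarith [norm_nonneg (E₄ z), norm_nonneg (E₆ z)]
  unfold djQuot
  rw [norm_div, norm_neg, norm_mul, norm_mul, norm_pow, div_le_iff₀ (by positivity)]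
  have h1 : ‖φ z‖ * ‖ModularForm.discriminant z‖ ≤ ‖φ z‖ * (2 * r) :=
    mul_le_mul_of_nonneg_left hΔ (norm_nonneg _)
  have h2 : 16 * ‖φ z‖ * r * (1 / 8) ≤ 16 * ‖φ z‖ * r * (‖E₄ z‖ ^ 2 * ‖E₆ z‖) :=
    mul_le_mul_of_nonneg_left hden (by positivity)
  linarith

/-! ### `j` is bounded on the truncated fundamental domain -/

/-- **`j` is bounded on `{z ∈ 𝒟 | im z ≤ M}`** (continuous on a compact set, Mathlib's
`ModularGroup.isCompact_truncatedFundamentalDomain`). [folklore] -/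
theorem exists_norm_kleinJ_le (M : ℝ) : ∃ R, ∀ z : ℍ, z ∈ 𝒟 → z.im ≤ M → ‖kleinJ z‖ ≤ R := by
  obtain ⟨R, hR⟩ := (ModularGroup.isCompact_truncatedFundamentalDomain M).exists_bound_of_continuousOn
    continuous_kleinJ.continuousOn
  exact ⟨R, fun z hz hM => hR z ⟨hz, hM⟩⟩

/-! ### Decay of `G = (ω/dj) ∘ ψ` -/

/-- **Decay of the tile integrand at infinity**: for a cusp function `φ` and any right inverse `ψ` of `j`
on the closed lower half plane with values in the closed half fundamental domain,
`(ω/dj)(ψ u) → 0` as `u → ∞`, `im u ≤ 0` (large `‖u‖ = ‖j(ψ u)‖` forces large `im ψ u`, where the cusp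
estimate applies). [folklore] -/
theorem djQuot_tileInv_decay {ψ : ℂ → ℍ}
    (hψ : ∀ u : ℂ, u.im ≤ 0 → ψ u ∈ {z : ℍ | z ∈ 𝒟 ∧ 0 ≤ z.re} ∧ kleinJ (ψ u) = u)
    {h : ℝ} {φ : ℍ → ℂ} (hφ : IsCuspFunction h φ) :
    ∀ ε > 0, ∃ R, ∀ u : ℂ, u.im ≤ 0 → R ≤ ‖u‖ → ‖djQuot φ (ψ u)‖ ≤ ε := by
  intro ε hε
  obtain ⟨C, hC0, hC⟩ := HaberlandStokes.exists_norm_apply_le hφ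
  obtain ⟨M, hM2, hM⟩ : ∃ M : ℝ, 2 ≤ M ∧ 16 * C * Real.exp (-(2 * Real.pi * M)) ≤ ε := by
    have h2π : Tendsto (fun y : ℝ => 2 * Real.pi * y) atTop atTop :=
      tendsto_id.const_mul_atTop (by positivity)
    have ht : Tendsto (fun y : ℝ => 16 * C * Real.exp (-(2 * Real.pi * y))) atTop (𝓝 (16 * C * 0)) :=
      tendsto_const_nhds.mul (Real.tendsto_exp_neg_atTop_nhds_zero.comp h2π)
    rw [mul_zero] at ht
    obtain ⟨M, hM⟩ := ((ht.eventually (Iic_mem_nhds hε)).and (eventually_ge_atTop 2)).exists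
    exact ⟨M, hM.2, hM.1⟩
  obtain ⟨R₀, hR₀⟩ := exists_norm_kleinJ_le M
  refine ⟨R₀ + 1, fun u hu hRu => ?_⟩
  obtain ⟨hH, hj⟩ := hψ u hu
  have hMz : M < (ψ u).im := by
    by_contra hle
    have hb := hR₀ (ψ u) hH.1 (not_lt.mp hle)
    rw [hj] at hb
    linarith
  have h2 : 2 ≤ (ψ u).im := hM2.trans hMz.le
  have hφb : ‖φ (ψ u)‖ ≤ C := by
    have hb := hC ((ψ u : ℍ) : ℂ) (by rw [UpperHalfPlane.coe_im]; linarith)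
    rw [ofComplex_apply] at hb
    refine hb.trans ?_
    have he : Real.exp (-(2 * Real.pi / h) * ((ψ u : ℍ) : ℂ).im) ≤ 1 := by
      rw [Real.exp_le_one_iff, UpperHalfPlane.coe_im]
      have := hφ.pos
      have := (ψ u).im_pos
      have : 0 < 2 * Real.pi / h := by positivity
      nlinarith
    nlinarith
  calc ‖djQuot φ (ψ u)‖ ≤ 16 * ‖φ (ψ u)‖ * Real.exp (-(2 * Real.pi * (ψ u).im)) :=
        norm_djQuot_le_of_two_le_im φ h2
    _ ≤ 16 * C * Real.exp (-(2 * Real.pi * M)) := by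
        gcongr
    _ ≤ ε := hM

end Summit.KontsevichZagierPeriods.HeckeMultiplicityOne.ManinStokes
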